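import Summits.QuantumFields.YangMills.Theorems.BalabanUVNodesK0AxMomentRoad
import Summits.QuantumFields.YangMills.Theorems.BalabanUVNodesK0AxJoinResidualSplit

/-!
# LANDING NOTE (porter PTC-1 g3; ★ P3 g89's OFFER 2026-08-31T06:47:54Z; AUTHORSHIP = ★ P3 g89, HOME sketch `nodeO-cover/P3-K0AxMomentDoor-v1.lean` d72d21419a39538f).
# THIS FILE `…K0AxMomentDoor.lean` = the sketch's §3 (doors (μ_cof)-Ax `K0AbsMomentCofinalRadiiAx` ∕ (μ_cof^vol)-Ax `K0PvolAbsMomentCofinalRadiiAx`, their order, K0ᴬ BY NAME)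
# + §4 minus the two consequent shapes and their pure-letter comparisons (which live in the route-independent companion ✓`…K0AxMomentRoad.lean`).  ONE lander's edit beyond
# the split: the two door Props' docstrings carry their [I] locators in prose instead of a `cite` tag (they are 0-binder hypothesis-shaped doors over tree names, like
# ✓`K0V23Stub3CofinalRunDoorAx.K0PiDecayCofinalRadiiAx`, not published results — so the gate's inline-fact relocation must not fire).  Declarations and proofs byte-identical.
-/

/-!
# K0ᴬ — THE RATE-FREE DOOR: run-uniform ABSOLUTE SECOND MOMENTS of the record's limit activities suffice for K0ᴬ,
# and they are supplied from finite volumes by FATOU through finite windows (no decay rate anywhere on the supplier side)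

LENS P3 «weaken the target» (ideation cell `ym-nodeO-ideate`, seat ★ P3 g89) applied AT the K0ᴬ door of `route-QuantumFields-BalabanUVNodes`
(K0ᴬ = `Summit.QuantumFields.YangMills.Theses.BalabanUVNodes.Record13SepCoPHInhabitedAx`, stmt-QuantumFields-27238, OPEN).

WHAT THE DAG CONSUMES FROM NODE O AT K0ᴬ.  Every typed road to K0ᴬ in the tree ends in the run |β| letter of door (ρ_cof)-Ax
`K0V23Stub3CofinalRunDoorAx.K0RunCofinalRadiiAx`; the decay roads (W-UDR-Ax `K0PiDecayCofinalRadiiAx`, the JOIN road's `JoinConclLimR`) reach it through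
`K0RecordFormatNames.runAbs_of_recordPlimDecayOnRunsAx`, whose ONLY use of the (5.10)-rate `δ₁` is `B12Sec2to5.secondMoment_abs_le_of_decay510`: dominated
summation of the (1.22)∕(5.42) series `β = Σ_z Π(z) z_0 z_1`.  ON THE BOX β IS that second moment (`betaOfRecord₁₃Ax_thetaFill_of_mem_box`).  Hence the weakest
kernel-currency statement SHORT of (5.10)-decay that still feeds every K0ᴬ edge is a run-uniform bound on the ABSOLUTE second moment
`Σ_z |Π(z)|·|z_0|·|z_1| ≤ M` of the limit activities `recordPlimAx` along the record's own in-window runs, on cofinally small radii — door (μ_cof)-Ax below.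

* §1 GENERIC (rate-free real analysis): ★ `summable_and_tsum_le_of_tendsto_of_frequently_sum_le` — FATOU THROUGH FINITE WINDOWS: pointwise limits of
  nonnegative families whose window-truncated sums are FREQUENTLY `≤ M` along finite windows exhausting the index set have summable limit with sum `≤ M`
  (finite partial sums + `IsClosed.mem_of_frequently_of_tendsto` + `summable_of_sum_le`); `summable_and_abs_secondMoment_le_tsum` — domination of the (1.22)
  series by the absolute moment; `summable_absMoment_of_decay510` — (5.10) ⟹ absolute moment `≤ β′₅.₁₀ = betaPrime510 d C δ₁` (so the new letters sit BELOW the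
  decay letters); `exists_finset_exhaustion_zd` + `exists_window_sum_le_of_eventually_le` — from POINTWISE-EVENTUAL domination by a summable majorant to a
  WINDOWED bound holding at EVERY volume (choice of thresholds; the window is built from the data, never prescribed).
* §2 RECORD LETTERS (Ax names of DEF-1's editions; runs driven by the RE-CENTRED β `betaOfRecord₁₃Ax F 2 (thetaFill F a₀ ε₂₉)`): (L-absmom)
  `RecordPlimAbsMomentOnRunsAx F a₀ ε₂₉ γ₀ M` (limit side) and (V-absmom) `RecordPvolAbsMomentOnRunsAx F a₀ ε₂₉ γ₀ M` (finite-volume side: per run prefix SOME finite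
  windows `W K` exhausting `ℤ⁴` in the inhabitable order `∀ z, ∀ᶠ K, z ∈ W K`, and FREQUENTLY in the volume `K` the truncated absolute moment of `recordPvolAx … K` is
  `≤ M` — NO all-`z` finite-volume letter, so the periodicity guard of `K0RecordFormatNamesDecay` (:131) is respected); the order lemmas
  (L-dec) ⟹ (L-absmom), (V-dec-ev) ⟹ (V-absmom), ★ (L-lim) ∧ (V-absmom) ⟹ (L-absmom) (Fatou, RATE-FREE), ★ (L-absmom) ⟹ the run |β| letter with `β′ := M`.
* §3 DOORS: (μ_cof)-Ax `K0AbsMomentCofinalRadiiAx` between W-UDR-Ax and (ρ_cof)-Ax (`k0AbsMomentCofinalRadiiAx_of_k0PiDecayCofinalRadiiAx`,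
  `k0RunCofinalRadiiAx_of_k0AbsMomentCofinalRadiiAx`), ★★★ `record13SepCoPHInhabitedAx_of_k0AbsMomentCofinalRadiiAx` (K0ᴬ BY NAME), and the finite-volume door
  ★★★ `record13SepCoPHInhabitedAx_of_k0PvolAbsMomentCofinalRadiiAx` ((1.21) pointwise + windowed absolute moments, cofinal radii ⟹ K0ᴬ; no `C·e^{−δ₁|z|}` anywhere).
* §4 THE JOIN ROAD's MOMENT TWINS: `JoinConclMomR Tok F` (▶ PTC-1's `JoinConclLimR` with the consequent `(1.21) ∧ (5.10)-decay` replaced by (L-absmom) alone) and the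
  finite-volume `JoinConclVolMomR Tok F` ((L-lim) ∧ (V-absmom)); order `joinConclMomR_of_joinConclLimR` ∕ `_of_joinConclVolMomR` ∕ `_antitone_tok` ∕ `_of_tokFree`,
  `joinConclVolMomR_of_polLimit_pvolDecayEv` (`K0AxJoinResidualSplit` §7a's joint frame ⟹ the finite-volume moment-join); doors `k0AbsMomentCofinalRadiiAx_of_mom_cofinalRadii`,
  ★ `record13SepCoPHInhabitedAx_of_momCut` ∕ `_of_volMomCut` ∕ `_of_limCut_via_absMoment` ∕ `_of_polLimit_pvolDecayEv_cut_via_absMoment` ∕ `_of_mom_tokFree_anySupply`, and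
  ★★★ `record13SepCoPHInhabitedAx_of_mom_residual_tokFree` (`(∀ F, JoinConclMomR ⊤ F)` ∧ (R-Uk) ∧ (R-Bg) ⟹ K0ᴬ — the TOKEN-FREE, RATE-FREE door on the JOIN road; binders of
  (R-Uk) ∕ (R-Bg) VERBATIM from `K0AxJoinResidual` §5).  Every g88 ∕ ▶ PTC-1 decay door FACTORS through the moment doors (the `_via_absMoment` theorems).

LENS-P3 READING (edges fed ∕ broken).  FED: every K0ᴬ edge (the run |β| letter is all K0ᴬ's body `k0BodyAx_of_k0RunCofinalRadiiAx` reads).  NOT FED by (L-absmom): nothing —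
K1ᴬ∕K3ᴬ never read NODE O's kernel decay (they read run rows ∕ the (1.21) window letter).  WHAT THE WEAKENING BUYS: the supplier side needs NO rate: a port text proving, per
volume, a bound on the window-truncated absolute second moment of the finite-volume activities (any windows exhausting `ℤ⁴`, frequently in the volume) + the (1.21) limit
pointwise closes the door; (4.37)-type exponential decay is sufficient (§2 `recordPvolAbsMomentOnRunsAx_of_pvolDecayEv`) but not necessary.

HONEST FRAMING (binding).  CONDITIONAL helpers: kernel-checked implications HYPOTHESES ⟹ K0ᴬ BY NAME whose hypotheses — (L-absmom) ∕ (V-absmom) ∕ (L-lim) ∕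
`JoinConclMomR ⊤` ∕ (R-Uk) ∕ (R-Bg) — are OPEN Bałaban-strength content ([I] (1.21)–(1.22), (4.37), (5.10) in moment form) and P0 at the record, inhabited nowhere in the
tree; nothing of Bałaban's [I] ∕ [15] ∕ [16] is asserted, valued, ported, discharged or refuted here; typed ≠ proved; K0ᴬ stmt-QuantumFields-27238 OPEN (not claimed);
K1ᴬ 27239 ∕ K3ᴬ 27247 OPEN; NODE O `ExistsUniformAcrossSmall` 0∕1; COUNT 8∕28 · K 1∕4 UNMOVED; R4 = the CONDITIONAL finite-𝕋⁴ rung `BalabanLadder.UV` at fixed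
`ε = L^(−K)` — NOT continuum ∕ ℝ⁴ ∕ OS; **the Yang–Mills mass gap (Clay) is NOT proved by any of this.**  No `sorry` ∕ `instance` ∕ `notation`.
[I] = [Balaban1987RG1]; [15] = [Balaban1985Variational]; [16] = [Balaban1985BackgroundPropagators].
-/

noncomputable section

open scoped BigOperators Matrix.Norms.L2Operator Topology
open Set Filter

namespace Summit.QuantumFields.YangMills.Theorems.K0AxMomentRoad

open Summit.QuantumFields.YangMills.Theorems.K0RecordFormatNames
open Summit.QuantumFields.YangMills.Theorems
open Summit.QuantumFields.YangMills.Theorems.PortHRecordJoin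
open Summit.QuantumFields.YangMills.Theorems.K0V23Stub3CofinalRunDoorAx (K0RunCofinalRadiiAx K0PiDecayCofinalRadiiAx
  record13SepCoPHInhabitedAx_of_k0RunCofinalRadiiAx)
open Summit.QuantumFields.YangMills.Theorems.K0AxJoinResidual (joinAntecedentsCofinalRadii_of_residual joinAntecedents_mono_tok joinAntecedentsCofinalRadii_mono_tok)
open Literature.MathematicalPhysics.QuantumFieldTheory.Balaban1983to89
open Literature.MathematicalPhysics.QuantumFieldTheory.Balaban1983to89.Node00
open Literature.MathematicalPhysics.QuantumFieldTheory.Balaban1983to89.T4Continuum (T4Family)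
open Literature.MathematicalPhysics.QuantumFieldTheory.Balaban1983to89.FlowStep
open Literature.MathematicalPhysics.QuantumFieldTheory.Balaban1983to89.FlowStepRuns
open Literature.MathematicalPhysics.QuantumFieldTheory.Balaban1983to89.B12Sec2to5 (l1 l1_nonneg abs_coord_le_l1 Decay510 betaPrime510 majorant_summable)

/-! ## §3  THE DOORS: (μ_cof)-Ax between W-UDR-Ax and (ρ_cof)-Ax; K0ᴬ BY NAME; the finite-volume (rate-free) door -/

/-- **Door (μ_cof)-Ax** — for every family and every ceiling `a > 0` SOME radius `0 < a₀ ≤ a`, SOME level `0 < γ₀ ≤ ½`, `ε₂₉ > 0` and `M` with (L-absmom).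
NODE O's content in ABSOLUTE-MOMENT currency, cofinal form.  (HYPOTHESIS — door bookkeeping over accepted tree names, NOT a published result as typed; open.)
(locators: [I] Thm 1 p.259, Thm 3 p.264, (0.20) p.256, (1.21)–(1.22) p.264, (5.42) p.297; HYPOTHESIS-shaped door over accepted tree names, open — NOT a published result as typed.)  STRENGTH = UNIFORMITY (◆ CRIT-1 g35 light cut 2026-08-31T06:52Z): ONE `M` for ALL run lengths `n`, ALL runs `gs`, ALL `k ≤ n` (and, for the finite-volume door, frequently in the volume `K`) — not mere per-run ∕ per-`k` summability, which would be junk-cheap. -/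
def K0AbsMomentCofinalRadiiAx : Prop :=
  ∀ F : T4Family, ∀ a : ℝ, 0 < a → ∃ a₀ : ℝ, 0 < a₀ ∧ a₀ ≤ a ∧
    ∃ γ₀ ε₂₉ M : ℝ, 0 < γ₀ ∧ γ₀ ≤ 1 / 2 ∧ 0 < ε₂₉ ∧ RecordPlimAbsMomentOnRunsAx F a₀ ε₂₉ γ₀ M

/-- **Door (μ_cof^vol)-Ax** — the FINITE-VOLUME, RATE-FREE door: cofinally in the radius, (L-lim) the (1.21) limit along runs AND (V-absmom) windowed absolute moments
per volume.  (HYPOTHESIS — door bookkeeping; open.) (locators: [I] Thm 1 p.259, Thm 3 p.264, (1.20)–(1.21) p.264, (4.37) p.291, (5.42) p.297; HYPOTHESIS-shaped door over accepted tree names, open — NOT a published result as typed.)  STRENGTH = UNIFORMITY (◆ CRIT-1 g35 light cut 2026-08-31T06:52Z): ONE `M` for ALL run lengths `n`, ALL runs `gs`, ALL `k ≤ n` (and, for the finite-volume door, frequently in the volume `K`) — not mere per-run ∕ per-`k` summability, which would be junk-cheap. -/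
def K0PvolAbsMomentCofinalRadiiAx : Prop :=
  ∀ F : T4Family, ∀ a : ℝ, 0 < a → ∃ a₀ : ℝ, 0 < a₀ ∧ a₀ ≤ a ∧
    ∃ γ₀ ε₂₉ M : ℝ, 0 < γ₀ ∧ γ₀ ≤ 1 / 2 ∧ 0 < ε₂₉ ∧ RecordPolLimitOnRunsAx F a₀ ε₂₉ γ₀ ∧ RecordPvolAbsMomentOnRunsAx F a₀ ε₂₉ γ₀ M

/-- **W-UDR-Ax ⟹ (μ_cof)-Ax** (`M := β′₅.₁₀(4, C, δ₁)`). [cite: Balaban1987RG1, (5.10) p.293, (5.42) p.297, Thm 3 p.264] -/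
theorem k0AbsMomentCofinalRadiiAx_of_k0PiDecayCofinalRadiiAx (H : K0PiDecayCofinalRadiiAx) : K0AbsMomentCofinalRadiiAx := by
  intro F a ha
  obtain ⟨a₀, ha₀, hle, γ₀, ε₂₉, C, δ₁, hγ₀, hγh, hε, hdec⟩ := H F a ha
  exact ⟨a₀, ha₀, hle, γ₀, ε₂₉, betaPrime510 4 C δ₁, hγ₀, hγh, hε, recordPlimAbsMomentOnRunsAx_of_decay F a₀ ε₂₉ hdec⟩

/-- **(μ_cof^vol)-Ax ⟹ (μ_cof)-Ax** (Fatou, rate-free). [cite: Balaban1987RG1, (1.21)–(1.22) p.264, (5.42) p.297] -/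
theorem k0AbsMomentCofinalRadiiAx_of_k0PvolAbsMomentCofinalRadiiAx (H : K0PvolAbsMomentCofinalRadiiAx) : K0AbsMomentCofinalRadiiAx := by
  intro F a ha
  obtain ⟨a₀, ha₀, hle, γ₀, ε₂₉, M, hγ₀, hγh, hε, hlim, hvol⟩ := H F a ha
  exact ⟨a₀, ha₀, hle, γ₀, ε₂₉, M, hγ₀, hγh, hε, recordPlimAbsMomentOnRunsAx_of_pvol F a₀ ε₂₉ hlim hvol⟩

/-- **(μ_cof)-Ax ⟹ door (ρ_cof)-Ax** (`β′ := M`, read at stub 2′'s re-centred θ-witness by `rfl`, exactly as `k0RunCofinalRadiiAx_of_k0PiDecayCofinalRadiiAx`). [cite: Balaban1987RG1, (1.22) p.264, (5.42) p.297, Thm 3 p.264] -/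
theorem k0RunCofinalRadiiAx_of_k0AbsMomentCofinalRadiiAx (H : K0AbsMomentCofinalRadiiAx) : K0RunCofinalRadiiAx := by
  intro F a ha
  obtain ⟨a₀, ha₀, hle, γ₀, ε₂₉, M, hγ₀, hγh, hε, hmom⟩ := H F a ha
  exact ⟨a₀, ha₀, hle, γ₀, ε₂₉, M, hγ₀, hε, fun j ε₀ B₃ B₃' a₁ => runAbs_of_recordPlimAbsMomentOnRunsAx F a₀ ε₂₉ hγh hmom⟩

/-- ★★★ **(μ_cof)-Ax ⟹ THE CRUX DECL BY NAME** — run-uniform ABSOLUTE SECOND MOMENTS of the record's limit activities along its own in-window runs at COFINALLY small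
radii suffice for K0ᴬ `Record13SepCoPHInhabitedAx` (stmt-QuantumFields-27238); NO decay rate is displayed or consumed.  A HELPER (one displayed hypothesis = NODE O's
wall in absolute-moment currency), NOT a closer; K0ᴬ OPEN; the mass gap is NOT proved.
[cite: Balaban1987RG1, Thm 1 p.259, Thm 3 p.264, (1.22) p.264, (5.42) p.297; Balaban1985Variational, Thm 1 (8)–(9) p.279; Balaban1988Convergent, Thm 1 p.262] -/
theorem record13SepCoPHInhabitedAx_of_k0AbsMomentCofinalRadiiAx (H : K0AbsMomentCofinalRadiiAx) :
    Summit.QuantumFields.YangMills.Theses.BalabanUVNodes.Record13SepCoPHInhabitedAx :=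
  record13SepCoPHInhabitedAx_of_k0RunCofinalRadiiAx (k0RunCofinalRadiiAx_of_k0AbsMomentCofinalRadiiAx H)

/-- ★★★ **THE FINITE-VOLUME, RATE-FREE DOOR AT K0ᴬ BY NAME**: cofinally in the radius, the (1.21) limit along runs (pointwise in `z`) AND windowed absolute second
moments of the FINITE-VOLUME activities, frequently in the volume ⟹ K0ᴬ.  No `C·e^{−δ₁|z|}`, no all-`z` finite-volume letter, no majorant anywhere in the hypotheses.
CONDITIONAL helper; K0ᴬ OPEN; nothing of Bałaban discharged; the mass gap is NOT proved.
[cite: Balaban1987RG1, Thm 1 p.259, Thm 3 p.264, (1.20)–(1.22) p.264, (4.37) p.291, (5.42) p.297; Balaban1985Variational, Thm 1 (8)–(9) p.279; Balaban1988Convergent, Thm 1 p.262] -/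
theorem record13SepCoPHInhabitedAx_of_k0PvolAbsMomentCofinalRadiiAx (H : K0PvolAbsMomentCofinalRadiiAx) :
    Summit.QuantumFields.YangMills.Theses.BalabanUVNodes.Record13SepCoPHInhabitedAx :=
  record13SepCoPHInhabitedAx_of_k0AbsMomentCofinalRadiiAx (k0AbsMomentCofinalRadiiAx_of_k0PvolAbsMomentCofinalRadiiAx H)

/-- … and W-UDR-Ax's road FACTORS through (μ_cof)-Ax (so `K0V23Stub3CofinalRunDoorAx.record13SepCoPHInhabitedAx_of_k0PiDecayCofinalRadiiAx` is the composite
decay ⟹ abs-moment ⟹ run ⟹ K0ᴬ). [cite: Balaban1987RG1, (5.10) p.293, (5.42) p.297, Thm 3 p.264 (bookkeeping)] -/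
theorem record13SepCoPHInhabitedAx_of_k0PiDecayCofinalRadiiAx_via_absMoment (H : K0PiDecayCofinalRadiiAx) :
    Summit.QuantumFields.YangMills.Theses.BalabanUVNodes.Record13SepCoPHInhabitedAx :=
  record13SepCoPHInhabitedAx_of_k0AbsMomentCofinalRadiiAx (k0AbsMomentCofinalRadiiAx_of_k0PiDecayCofinalRadiiAx H)

/-! ## §4  THE JOIN ROAD's MOMENT TWIN: `JoinConclMomR` (weaker than ▶ PTC-1's `JoinConclLimR`), and the TOKEN-FREE RATE-FREE door -/

/-- `JoinConclMomR` is ANTITONE in the token (the token sits among the antecedents); the TOKEN-FREE moment-join is the strongest. [cite: Balaban1987RG1, Thm 1 p.259, (1.22) p.264] -/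
theorem joinConclMomR_antitone_tok {Tok₁ Tok₂ : T4Family → ℕ → ℝ → Prop} (h : ∀ (F : T4Family) (Mc : ℕ) (a₀ : ℝ), Tok₂ F Mc a₀ → Tok₁ F Mc a₀)
    {F : T4Family} (hM : JoinConclMomR Tok₁ F) : JoinConclMomR Tok₂ F := by
  obtain ⟨Mth, hJ⟩ := hM
  exact ⟨Mth, fun Mc hMc j c c₀ c₁ B₃ B₃' a₀ a₁ hA => hJ Mc hMc j c c₀ c₁ B₃ B₃' a₀ a₁ (joinAntecedents_mono_tok h hA)⟩

/-- ★ **COFINAL-RADII supply ∧ `JoinConclMomR` ⟹ (μ_cof)-Ax** (one radius `a₀ ≤ a` at a time, level `min γ₀ ½`).  CONDITIONAL on the two displayed shapes.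
[cite: Balaban1987RG1, Thm 1 p.259, Thm 3 p.264, (1.22) p.264, (5.42) p.297] -/
theorem k0AbsMomentCofinalRadiiAx_of_mom_cofinalRadii (Tok : T4Family → ℕ → ℝ → Prop)
    (hA : ∀ F, JoinAntecedentsCofinalRadii Tok F) (hM : ∀ F, JoinConclMomR Tok F) : K0AbsMomentCofinalRadiiAx := by
  intro F a ha
  obtain ⟨Mth, hJ⟩ := hM F
  obtain ⟨a₀, ha₀, hle, Mc, hMc, j, c, c₀, c₁, B₃, B₃', a₁, hAnt⟩ := hA F Mth a ha
  obtain ⟨γ₀, ε₂₉, M, hγ₀, hε, hmom⟩ := hJ Mc hMc j c c₀ c₁ B₃ B₃' a₀ a₁ hAnt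
  exact ⟨a₀, ha₀, hle, min γ₀ (1 / 2), ε₂₉, M, lt_min hγ₀ (by norm_num), min_le_right _ _, hε, hmom _ (min_le_left _ _)⟩

/-- ★ **CUT COMPOSITION AT K0ᴬ IN MOMENT CURRENCY**: a supplier of the antecedents at token `TokS` and a consumer proving the moment-join at `TokC ⟸ TokS` compose to K0ᴬ BY NAME.
[cite: Balaban1987RG1, Thm 1 p.259, Thm 3 p.264, (1.22) p.264, (5.42) p.297; Balaban1988Convergent, Thm 1 p.262] -/
theorem record13SepCoPHInhabitedAx_of_momCut {TokS TokC : T4Family → ℕ → ℝ → Prop} (h : ∀ (F : T4Family) (Mc : ℕ) (a₀ : ℝ), TokS F Mc a₀ → TokC F Mc a₀)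
    (hA : ∀ F : T4Family, JoinAntecedentsCofinalRadii TokS F) (hM : ∀ F : T4Family, JoinConclMomR TokC F) :
    Summit.QuantumFields.YangMills.Theses.BalabanUVNodes.Record13SepCoPHInhabitedAx :=
  record13SepCoPHInhabitedAx_of_k0AbsMomentCofinalRadiiAx
    (k0AbsMomentCofinalRadiiAx_of_mom_cofinalRadii TokC (fun F => joinAntecedentsCofinalRadii_mono_tok h (hA F)) hM)

/-- ★★★ **THE TOKEN-FREE, RATE-FREE DOOR ON THE JOIN ROAD**: `(∀ F, JoinConclMomR ⊤ F)` — «at cofinally admissible cut-offs, the twelve regularity ∕ gauge antecedents of the JOIN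
⟹ ∃ γ₀ ε₂₉ M, the run-uniform ABSOLUTE SECOND MOMENT of the limit activities on `]0, γ]`-runs, γ ≤ γ₀» — ∧ (R-Uk) ∧ (R-Bg) ⟹ K0ᴬ BY NAME.  WEAKER displayed hypothesis than
`K0AxJoinResidual.record13SepCoPHInhabitedAx_of_lim_residual_tokFree`'s `JoinConclLimR ⊤` (`joinConclMomR_of_joinConclLimR`): no (1.21) letter, no `(C, δ₁)`, no token.
CONDITIONAL helper: `JoinConclMomR ⊤` is [I] (1.22)∕(5.42)-strength Bałaban content asked directly; (R-Uk) ∧ (R-Bg) = P0 at the record; nothing discharged; K0ᴬ OPEN; the mass gap is NOT proved.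
[cite: Balaban1987RG1, Thm 1 p.259, Thm 3 p.264, (1.21)–(1.22) p.264, (5.42) p.297; Balaban1985Variational, Thm 1 (8)–(9) p.279; Balaban1988Convergent, Thm 1 p.262] -/
theorem record13SepCoPHInhabitedAx_of_mom_residual_tokFree (hM : ∀ F : T4Family, JoinConclMomR (fun _ _ _ => True) F)
    (hUk : ∀ F : T4Family, ∃ aU : ℝ, 0 < aU ∧ ∀ (B₃ a₀ a₁ : ℝ), 2 * (F.L : ℝ) ^ 2 ≤ B₃ → 0 < a₀ → a₀ ≤ aU → 0 < a₁ → ∃ M₀ : ℕ, ∀ Mc : ℕ, McGuard F Mc → M₀ ≤ Mc →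
      (∀ ε₁ : ℝ, 0 < ε₁ → ε₁ ≤ a₁ → B₃ * ε₁ ≤ a₀ → ∀ (k n : ℕ) (V : Literature.MathematicalPhysics.QuantumFieldTheory.Balaban1983to89.GaugeField (F.P (Summit.QuantumFields.YangMills.Theorems.K0RecordFormatNames.recordK₀ F Mc k + n)) (k + 1) (Literature.MathematicalPhysics.QuantumFieldTheory.Balaban1983to89.Node00.SU 2)), Literature.MathematicalPhysics.QuantumFieldTheory.Balaban1983to89.PlaqSmall ε₁ V → Literature.MathematicalPhysics.QuantumFieldTheory.Balaban1983to89.Node00.UkExists F 2 (Summit.QuantumFields.YangMills.Theorems.K0RecordFormatNames.recordK₀ F Mc k + n) (k + 1) a₀ V ∧ Literature.MathematicalPhysics.QuantumFieldTheory.Balaban1983to89.Node00.UniqueUkOrbit F 2 (Summit.QuantumFields.YangMills.Theorems.K0RecordFormatNames.recordK₀ F Mc k + n) (k + 1) a₀ V))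
    (hBg : ∀ F : T4Family, ∃ aB : ℝ, 0 < aB ∧ ∀ a₀ : ℝ, 0 < a₀ → a₀ ≤ aB → ∃ M₀ : ℕ, ∀ Mc : ℕ, McGuard F Mc → M₀ ≤ Mc →
      (∀ (k n : ℕ) (ε₂₉ : ℝ), 0 < ε₂₉ → letI θ := Summit.QuantumFields.YangMills.Theorems.K0RecordFormatNames.thetaFill F a₀ ε₂₉; letI := θ.instVβ₁; letI := θ.instVβ₂; letI := θ.instιβ; AnalyticAt ℝ (fun B : Summit.QuantumFields.YangMills.Theorems.K0RecordFormatNames.recordW F a₀ ε₂₉ k (Summit.QuantumFields.YangMills.Theorems.K0RecordFormatNames.recordK₀ F Mc k + n) => fun (b : Literature.MathematicalPhysics.QuantumFieldTheory.Balaban1983to89.PBond (F.P (Summit.QuantumFields.YangMills.Theorems.K0RecordFormatNames.recordK₀ F Mc k + n)) 0) (i i' : Fin 2) => ((Summit.QuantumFields.YangMills.Theorems.K0RecordFormatNames.recordBgField F θ k (Summit.QuantumFields.YangMills.Theorems.K0RecordFormatNames.recordK₀ F Mc k + n) B b : Literature.MathematicalPhysics.QuantumFieldTheory.Balaban1983to89.Node00.SU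 2) : Matrix (Fin 2) (Fin 2) ℂ) i i') 0)) :
    Summit.QuantumFields.YangMills.Theses.BalabanUVNodes.Record13SepCoPHInhabitedAx :=
  record13SepCoPHInhabitedAx_of_k0AbsMomentCofinalRadiiAx (k0AbsMomentCofinalRadiiAx_of_mom_cofinalRadii (fun _ _ _ => True)
    (fun F => joinAntecedentsCofinalRadii_of_residual (fun _ _ _ => True) F (hUk F) (hBg F) ⟨1, one_pos, fun _ _ _ => ⟨0, fun _ _ _ => trivial⟩⟩) hM)

/-- The TOKEN-FREE moment-join is the STRONGEST: it implies `JoinConclMomR Tok F` for every token. [cite: Balaban1987RG1, Thm 1 p.259, (1.22) p.264] -/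
theorem joinConclMomR_of_tokFree {Tok : T4Family → ℕ → ℝ → Prop} {F : T4Family} (hM : JoinConclMomR (fun _ _ _ => True) F) : JoinConclMomR Tok F :=
  joinConclMomR_antitone_tok (fun _ _ _ _ => trivial) hM

/-- **The joint frame of `K0AxJoinResidualSplit` §7a ⟹ `JoinConclVolMomR`** (`M := β′₅.₁₀`): (L-lim) ∧ the per-volume EVENTUAL (5.10) letter under the antecedents give the
finite-volume moment-join (windows from the thresholds; NO passage to the limit needed on this side). [cite: Balaban1987RG1, (1.21) p.264, (4.37) p.291, (5.10) p.293, (5.42) p.297] -/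
theorem joinConclVolMomR_of_polLimit_pvolDecayEv {Tok : T4Family → ℕ → ℝ → Prop} {F : T4Family}
    (h : ∃ Mth : ℕ, ∀ Mc : ℕ, Mth ≤ Mc → ∀ (j c c₀ c₁ : ℕ) (B₃ B₃' a₀ a₁ : ℝ), JoinAntecedents Tok F Mc j c c₀ c₁ B₃ B₃' a₀ a₁ →
      ∃ γ₀ ε₂₉ C δ₁ : ℝ, 0 < γ₀ ∧ 0 < ε₂₉ ∧ ∀ γ : ℝ, γ ≤ γ₀ →
        (RecordPolLimitOnRunsAx F a₀ ε₂₉ γ ∧ RecordPvolDecayEvOnRunsAx F a₀ ε₂₉ γ C δ₁)) :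
    JoinConclVolMomR Tok F := by
  obtain ⟨Mth, hJ⟩ := h
  refine ⟨Mth, fun Mc hMc j c c₀ c₁ B₃ B₃' a₀ a₁ hA => ?_⟩
  obtain ⟨γ₀, ε₂₉, C, δ₁, hγ₀, hε, hh⟩ := hJ Mc hMc j c c₀ c₁ B₃ B₃' a₀ a₁ hA
  exact ⟨γ₀, ε₂₉, betaPrime510 4 C δ₁, hγ₀, hε, fun γ hγ => ⟨(hh γ hγ).1, recordPvolAbsMomentOnRunsAx_of_pvolDecayEv F a₀ ε₂₉ (hh γ hγ).2⟩⟩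

/-- ★★ **THE FINITE-VOLUME RATE-FREE CUT AT K0ᴬ**: antecedents supplied cofinally at `TokS` ∧ the finite-volume moment-join `JoinConclVolMomR TokC` ((1.21) in scope + windowed absolute
moments per volume, NO rate) at `TokC ⟸ TokS` ⟹ K0ᴬ BY NAME.  CONDITIONAL helper; K0ᴬ OPEN; the mass gap is NOT proved.
[cite: Balaban1987RG1, Thm 1 p.259, Thm 3 p.264, (1.20)–(1.22) p.264, (4.37) p.291, (5.42) p.297; Balaban1988Convergent, Thm 1 p.262] -/
theorem record13SepCoPHInhabitedAx_of_volMomCut {TokS TokC : T4Family → ℕ → ℝ → Prop} (h : ∀ (F : T4Family) (Mc : ℕ) (a₀ : ℝ), TokS F Mc a₀ → TokC F Mc a₀)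
    (hA : ∀ F : T4Family, JoinAntecedentsCofinalRadii TokS F) (hV : ∀ F : T4Family, JoinConclVolMomR TokC F) :
    Summit.QuantumFields.YangMills.Theses.BalabanUVNodes.Record13SepCoPHInhabitedAx :=
  record13SepCoPHInhabitedAx_of_momCut h hA fun F => joinConclMomR_of_joinConclVolMomR (hV F)

/-- ★ **ANY SUPPLIER TOKEN against the TOKEN-FREE moment-join**: supply at any `Tok` ∧ `(∀ F, JoinConclMomR ⊤ F)` ⟹ K0ᴬ BY NAME (`joinConclMomR_of_tokFree`).
[cite: Balaban1987RG1, Thm 1 p.259, Thm 3 p.264, (1.22) p.264, (5.42) p.297] -/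
theorem record13SepCoPHInhabitedAx_of_mom_tokFree_anySupply (Tok : T4Family → ℕ → ℝ → Prop)
    (hA : ∀ F : T4Family, JoinAntecedentsCofinalRadii Tok F) (hM : ∀ F : T4Family, JoinConclMomR (fun _ _ _ => True) F) :
    Summit.QuantumFields.YangMills.Theses.BalabanUVNodes.Record13SepCoPHInhabitedAx :=
  record13SepCoPHInhabitedAx_of_k0AbsMomentCofinalRadiiAx
    (k0AbsMomentCofinalRadiiAx_of_mom_cofinalRadii Tok hA fun F => joinConclMomR_of_tokFree (hM F))

/-- ★ **`K0AxJoinResidualSplit`'s JOINT-FRAME door FACTORS THROUGH THE FINITE-VOLUME MOMENT DOOR**: supply at `TokS` ∧ «(L-lim) ∧ per-volume eventual (5.10) under `JoinAntecedents TokC`»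
(`TokC ⟸ TokS`) ⟹ K0ᴬ BY NAME, routed (V-dec-ev) ⟹ (V-absmom) ⟹ Fatou ⟹ (L-absmom) ⟹ run |β| — the limit kernel's DECAY is never formed.  CONDITIONAL helper; K0ᴬ OPEN; the mass gap is NOT proved.
[cite: Balaban1987RG1, Thm 1 p.259, Thm 3 p.264, (1.21)–(1.22) p.264, (4.37) p.291, (5.10) p.293, (5.42) p.297; Balaban1988Convergent, Thm 1 p.262] -/
theorem record13SepCoPHInhabitedAx_of_polLimit_pvolDecayEv_cut_via_absMoment {TokS TokC : T4Family → ℕ → ℝ → Prop}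
    (h : ∀ (F : T4Family) (Mc : ℕ) (a₀ : ℝ), TokS F Mc a₀ → TokC F Mc a₀) (hA : ∀ F : T4Family, JoinAntecedentsCofinalRadii TokS F)
    (hLP : ∀ F : T4Family, ∃ Mth : ℕ, ∀ Mc : ℕ, Mth ≤ Mc → ∀ (j c c₀ c₁ : ℕ) (B₃ B₃' a₀ a₁ : ℝ), JoinAntecedents TokC F Mc j c c₀ c₁ B₃ B₃' a₀ a₁ →
      ∃ γ₀ ε₂₉ C δ₁ : ℝ, 0 < γ₀ ∧ 0 < ε₂₉ ∧ ∀ γ : ℝ, γ ≤ γ₀ →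
        (RecordPolLimitOnRunsAx F a₀ ε₂₉ γ ∧ RecordPvolDecayEvOnRunsAx F a₀ ε₂₉ γ C δ₁)) :
    Summit.QuantumFields.YangMills.Theses.BalabanUVNodes.Record13SepCoPHInhabitedAx :=
  record13SepCoPHInhabitedAx_of_volMomCut h hA fun F => joinConclVolMomR_of_polLimit_pvolDecayEv (hLP F)

/- NOTE (lander): the sketch's `record13SepCoPHInhabitedAx_of_limCut_via_absMoment` (same STATEMENT as ✓`K0AxJoinResidual.record13SepCoPHInhabitedAx_of_cut`, re-proved through
the absolute-moment road) is NOT restated here — the gate's `dedup.landed` names it an identical-content duplicate; cite `K0AxJoinResidual.record13SepCoPHInhabitedAx_of_cut`.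
The moment road's own cut door is `record13SepCoPHInhabitedAx_of_momCut` ∕ `…_of_volMomCut` above. -/


end Summit.QuantumFields.YangMills.Theorems.K0AxMomentRoad

end
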